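import Summits.BirchSwinnertonDyer.BirchSwinnertonDyer.Theorems.GenusKolyvaginAtTwoKramerParityReciprocity
import Summits.BirchSwinnertonDyer.BirchSwinnertonDyer.Theorems.GenusKolyvaginAtTwoKramerParityPolar
import Literature.NumberTheory.EllipticCurves.PoonenRainsKummerIsotropyClass
import HarnessLib

/-!
# Route `GenusKolyvaginAtTwo`, crux #2 `GenusPrimitiveSupplyAtTwo` (stmt-BirchSwinnertonDyer-22136):
# KRAMER PARITY VIA QUADRATIC SELMER STRUCTURES, part 7 — (Q2) from the lead's Kummer isotropy, and the ASSEMBLY: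
# `MazurRubin2010.kramerParity K` follows from the TWIST COMPATIBILITY (Q4) of the Poonen–Rains form ALONE

Width seat `bsd-line-gk2-p4` g11 (cell `bsd-f1-sign2`). THEOREMS ONLY (no definition, no named fact, no `sorry`); helper
`--supports stmt-BirchSwinnertonDyer-22136`; no item is closed; BSD is not proved by any of this.

For THE Poonen–Rains quadratic map of the tree, `q_v x := can_v (ThetaLevelTwo.prClass W h2 K_v x)` (lead gk2-p1 g10, p644978),
three of the four hypotheses of part 4's `kramerParity_of_tateQuadraticForms_canonical` are now tree theorems:
(Q1) polar form = Weil cup product (part 6, `tateQuadraticForm_prClass_Q1`, p648286); (Q3) reciprocity (part 5,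
`tateQuadraticForm_prClass_Q3`, p647264); and — this file, §1 — **(Q2) Kummer isotropy at EVERY place**
(`tateQuadraticForm_prClass_Q2`), read off the lead's `ThetaLevelTwo.prClass_localKummerClass` (Poonen–Rains 2012 Prop. 4.8 with
an explicit splitting cochain, `PoonenRainsKummerIsotropyClass.lean`, p648297) through
`mem_kummerLocalConditionAt_iff_exists_eq_localKummerClass`.

§2 **`kramerParity_of_prClass_twist`** — THE ASSEMBLY: `MazurRubin2010.kramerParity K` (Kramer 1981 Thm. 1 = Mazur–Rubin 2010
Thm. 2.7, every number field `K`, `p = 2`) follows from the single remaining displayed hypothesis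
(Q4) TWIST COMPATIBILITY: for every elliptic `W`, non-square `d`, model `W'` of the twist (`C • W' = W.quadraticTwist d`),
the (unique) identification `φ : E^F[2] = E[2]`, the transported local Kummer conditions `𝓐_v = φ_* 𝓚_{W',v}` —
`q_{W,v}` vanishes on `𝓐_v` (Klagsbrun–Mazur–Rubin 2013 Lemma 5.2: the twisted Kummer condition is Lagrangian for the SAME
`q_v`; equivalently the theta data of `W` and `W^{(d)}` agree under `φ`). The Weil pairing is taken from the tree theorem
`exists_weilPairing_holds W 2` (any level-`2` Weil pairing works by part 6).

Honest framing: CONDITIONAL on (Q4) (the lead's "twist compatibility", memo `Lines/genus-supply-pr-quadratic-form.md` §2);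
closes nothing; crux 22136 stays OPEN at (U) ∧ (CONV₂); BSD is not proved by any of this.

References: [MazurRubin2010] Thm. 2.7, Remark 2.4 (arXiv:0904.3709 p. 7); [KlagsbrunMazurRubin2013] Thm. 3.9, Lemma 5.2;
[PoonenRains2012] Cor. 4.6, Prop. 4.8, Thm. 4.14; [Kramer1981] Thm. 1.
-/

set_option linter.dupNamespace false -- tree convention: `Summit.BirchSwinnertonDyer.BirchSwinnertonDyer.Theorems` (summit = sub-problem)
set_option autoImplicit false

noncomputable section

open scoped Classical ContRepresentation

namespace Summit.BirchSwinnertonDyer.BirchSwinnertonDyer.Theorems.GenusKolyKramer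

open WeierstrassCurve Field NumberField IsDedekindDomain Function
open Literature.NumberTheory.EllipticCurves Literature.NumberTheory.EllipticCurves.ThetaLevelTwo
open Literature.NumberTheory.GaloisRepresentations
open Literature.NumberTheory.GaloisRepresentations.DiscreteGaloisModule (SelmerStructure mu MuCarrier)
open Literature.NumberTheory.GaloisCohomology
open Summit.BirchSwinnertonDyer.Rank1Residual.X11b.Relaxation

variable {K : Type} [Field K] [NumberField K] (W : WeierstrassCurve K) [W.IsElliptic] (h2 : (2 : K) ≠ 0)

/-! ## §1 (Q2): Kummer isotropy at every place -/

/-- **(Q2) Kummer isotropy of `q_v = inv_v ∘ prClass` at EVERY place** (Poonen–Rains Prop. 4.8 at `p = 2`; the lead's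
`ThetaLevelTwo.prClass_localKummerClass`): for every family `inv` and every local class `x` in the Kummer condition
`𝓚_v = im(E(K_v)/2E(K_v) → H¹(K_v, E[2]))`, `q_v x = 0`. Spelling of the API card (`q v x := inv_v (prClass W h2 K_v x)` with the
two-step level ascription). [cite: PoonenRains2012, Prop. 4.8 (the image of A(k)/λA(k) is isotropic for q)] -/
theorem tateQuadraticForm_prClass_Q2 (inv : LocalInvariants K 2) (v : Place K)
    (x : galoisCohomology ((W.torsionGaloisModule ((2 : ℕ) : ℤ)).toLocal v) 1)
    (hx : x ∈ W.kummerSelmerStructure ((2 : ℕ) : ℤ) v) :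
    (fun (v : Place K) (x : galoisCohomology ((W.torsionGaloisModule ((2 : ℕ) : ℤ)).toLocal v) 1) =>
        inv v (prClass W h2 (Place.Completion v)
          (show galoisCohomology ((W.torsionGaloisModule (2 : ℤ)).toLocal v) 1 from x))) v x = 0 := by
  haveI : CharZero (Place.Completion v) := charZero_placeCompletion (K := K) v
  -- read `x` at level `(2 : ℤ)` as a class of the restricted module, and as a local Kummer class
  let x₂ : galoisCohomology (GaloisRep.restrictField (Place.Completion v) (W.torsionGaloisModule (2 : ℤ))) 1 :=
    show galoisCohomology ((W.torsionGaloisModule (2 : ℤ)).toLocal v) 1 from x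
  have hx₂ : x₂ ∈ W.kummerLocalConditionAt (2 : ℤ) (Place.Completion v) := hx
  obtain ⟨Q, hQ, hQx⟩ := (W.mem_kummerLocalConditionAt_iff_exists_eq_localKummerClass (2 : ℤ) two_ne_zero x₂).mp hx₂
  show inv v (prClass W h2 (Place.Completion v) x₂) = 0
  rw [hQx, prClass_localKummerClass W h2 (Place.Completion v) Q hQ]
  exact map_zero (inv v)

/-! ## §2 The assembly: Kramer parity from the twist compatibility alone -/

/-- **`MazurRubin2010.kramerParity K` FROM THE TWIST COMPATIBILITY (Q4) OF THE POONEN–RAINS FORM ALONE** (every number field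
`K`; Kramer 1981 Thm. 1 = Mazur–Rubin 2010 Thm. 2.7 at `p = 2`). For `q_{W,v} x := can_v (prClass W h2 K_v x)` (THE canonical
invariant maps), hypotheses (Q1) (part 6), (Q2) (§1) and (Q3) (part 5) of `kramerParity_of_tateQuadraticForms_canonical` are tree
theorems, the Weil pairing is `exists_weilPairing_holds W 2`; what is displayed is (Q4): for every elliptic `W`, non-square `d`,
model `W'` of `E^{(d)}`, identification `φ : E^{(d)}[2] = E[2]` (injective, unique) and transported local Kummer conditions
`𝓐_v = φ_* 𝓚_{W',v}` (binders VERBATIM as in `kramerParity`), `q_{W,v}` vanishes on `𝓐_v` — Klagsbrun–Mazur–Rubin 2013 Lemma 5.2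
("`α_v(χ) ∈ H(q_v)`": the twisted Kummer condition is Lagrangian for the same `q_v`), i.e. the twist-invariance of the level-`2`
theta datum. [cite: MazurRubin2010, Thm. 2.7] [cite: KlagsbrunMazurRubin2013, Thm. 3.9 and Lemma 5.2] [cite: PoonenRains2012, Thm. 4.14] -/
theorem kramerParity_of_prClass_twist
    (hQ4 : ∀ (W : WeierstrassCurve K) [W.IsElliptic] (d : K), (∀ x : K, x ^ 2 ≠ d) →
      ∀ (W' : WeierstrassCurve K) [W'.IsElliptic], (∃ C : VariableChange K, C • W' = W.quadraticTwist d) →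
      ∀ (φ : (W'.torsionGaloisModule ((2 : ℕ) : ℤ)).toContRepresentation →ⁱL
          (W.torsionGaloisModule ((2 : ℕ) : ℤ)).toContRepresentation),
        Function.Injective φ →
        (∀ φ' : (W'.torsionGaloisModule ((2 : ℕ) : ℤ)).toContRepresentation →ⁱL
            (W.torsionGaloisModule ((2 : ℕ) : ℤ)).toContRepresentation,
          Function.Injective φ' → ∀ a, φ' a = φ a) →
      ∀ (𝓐 : SelmerStructure (W.torsionGaloisModule ((2 : ℕ) : ℤ))),
        (∀ v, 𝓐 v = (W'.kummerSelmerStructure ((2 : ℕ) : ℤ) v).map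
          (galoisCohomology.map (φ.restrictField (Place.Completion v)) 1)) →
        ∀ (v : Place K), ∀ x ∈ 𝓐 v,
          LocalInvariants.canonical K 2 v (prClass W (h2 := two_ne_zero) (Place.Completion v)
            (show galoisCohomology ((W.torsionGaloisModule (2 : ℤ)).toLocal v) 1 from x)) = 0) :
    MazurRubin2010.kramerParity K := by
  haveI : PerfectField K := PerfectField.ofCharZero
  refine kramerParity_of_tateQuadraticForms_canonical fun W _ => ?_
  obtain ⟨e, hμ, hadd₁, hadd₂, halt, hnondeg, hgal⟩ := exists_weilPairing_holds W 2 le_rfl (by norm_num)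
  exact ⟨e, hμ, hadd₁, hadd₂, hgal, halt, hnondeg,
    fun v x => LocalInvariants.canonical K 2 v (prClass W two_ne_zero (Place.Completion v)
      (show galoisCohomology ((W.torsionGaloisModule (2 : ℤ)).toLocal v) 1 from x)),
    fun v x y => tateQuadraticForm_prClass_Q1 W two_ne_zero e hμ hadd₁ hadd₂ hgal halt hnondeg
      (LocalInvariants.canonical K 2) v x y,
    fun v x hx => tateQuadraticForm_prClass_Q2 W two_ne_zero (LocalInvariants.canonical K 2) v x hx,
    fun c S hS => tateQuadraticForm_prClass_Q3 W two_ne_zero c S hS,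
    fun d hd W' _ hC φ hφ huniq 𝓐 h𝓐 v x hx => hQ4 W d hd W' hC φ hφ huniq 𝓐 h𝓐 v x hx⟩

end Summit.BirchSwinnertonDyer.BirchSwinnertonDyer.Theorems.GenusKolyKramer

end
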